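import Literature.Topology.FourManifolds.PuncturedTubeMiddleHomology
import Literature.GroupTheory.FiniteAbelian.CyclicKernelQuotients
import HarnessLib

/-!
# Removing a framed `k`-sphere from a `(2k+1)`-manifold: `H_k(X ∖ S) → H_k(X)` is onto with kernel
# the meridian class (Kervaire–Milnor's Lemma 5.6, horizontal sequence)

Topic `Literature/Topology/FourManifolds`; second brick (after `PuncturedTubeMiddleHomology.lean`)
towards Kervaire–Milnor's **Lemma 5.6** (*Groups of homotopy spheres I*, Ann. of Math. (2) 77
(1963), pp. 514–516) for the tree's surgery along a framed sphere in the middle dimension. For a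
framed family with one sphere `ν : Sᵏ × ℝᵏ⁺¹ ↪ X` (`FramedSphereFamily IX X ι k (k + 1)`,
`[Unique ι]`, `X` Hausdorff) this file PROVES the horizontal exact sequence of Kervaire–Milnor's
diagram (p. 515), `Z →ε'→ H_kM₀ →i→ H_kM → 0`, in the form

* `FramedSphereFamily.surjective_map_complement_and_ker_eq` — for `k ≥ 2` and a generator `θ` of
  `H_k(Sᵏ; ℤ)`, the map `H_k(X ∖ S; ℤ) → H_k(X; ℤ)` induced by the inclusion of the complement of
  the core is ONTO, with kernel the cyclic subgroup generated by the class of the **meridian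
  sphere** `v ↦ φ(u₀, ½ v)` (`FramedSphereFamily.meridianSphere`; "The element `ε'` … can clearly
  be described as the homology class corresponding to the meridian `φ(x₀ × Sᵏ)`", p. 515).

Kervaire–Milnor argue with the exact sequence of the pair `(M, M₀)` and excision; here, as in
`SphereSurgeryHomology.lean`, with the Mayer–Vietoris sequence of the open cover
`X = (X ∖ S) ∪ φ(Sᵏ × Bᵏ⁺¹)` (`complement_union_openTube`), whose pieces meet in the punctured
tube `φ(Sᵏ × (Bᵏ⁺¹ ∖ 0))` (`complement_inter_openTube`): its `H_k` is generated by the meridian and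
the parallel and its `H_{k-1}` vanishes (`PuncturedTubeMiddleHomology`, `SphereSurgeryHomology`);
in the tube `≃ Sᵏ` the meridian dies and the parallel is a generator; exactness is the tree's
`mayerVietoris.exact₁_holds`, `exact₂_holds`; the diagram chase is
`surjective_and_ker_eq_zmultiples_of_mayerVietoris` (`CyclicKernelQuotients.lean`). The open model
`X ∖ S` of `M₀ = M ∖ int φ(Sᵏ × Dᵏ⁺¹)` is the one the tree's surgery is glued from; the cover, its
models (`unitTube`, `openTube`, `interHomeomorph`, `openTubeHomeomorph`, `tubeIncl`) and the
meridian/parallel of the punctured tube (`meridianPT`, `parallelPT`) are the tree's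
(`SphereSurgeryHandleMeridian.lean`, `SphereSurgeryHandleParallel.lean`, where `k ≠ l`).
Everything is proved; the only definition (with body) is the meridian sphere `meridianSphere` in
`X ∖ S`.

## References

* M. Kervaire, J. Milnor, *Groups of homotopy spheres I*, Ann. of Math. (2) 77 (1963), Lemma 5.6
  and its proof (pp. 514–516). doi:10.2307/1970128 [KervaireMilnorAnnals1963]
* A. Hatcher, *Algebraic Topology*, CUP (2002), §2.2 (Mayer–Vietoris), Cor. 2.11. [HatcherAT2002]
-/

noncomputable section

open scoped Topology unitInterval
open Set Function Metric CategoryTheory CategoryTheory.Limits AddSubgroup Topology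
open Literature.AlgebraicTopology.SingularHomology

namespace Literature.Topology.FourManifolds

/-- Local notation: `𝔼 n` is the model Euclidean space `EuclideanSpace ℝ (Fin n)`. -/
local notation "𝔼 " n:arg => EuclideanSpace ℝ (Fin n)

/-- Local notation: `𝕊 n` is the unit sphere in `EuclideanSpace ℝ (Fin (n + 1))`. -/
local notation "𝕊 " n:arg => (Metric.sphere (0 : EuclideanSpace ℝ (Fin (n + 1))) 1)

/-! ### The meridian in the complement of the core, and the tube cover of `X` -/

namespace FramedSphereFamily

variable {EX HX : Type*} [NormedAddCommGroup EX] [NormedSpace ℝ EX] [TopologicalSpace HX]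
  {IX : ModelWithCorners ℝ EX HX} {X : Type} [TopologicalSpace X] [ChartedSpace HX X] [T2Space X]
  {ι : Type} [Unique ι] {k : ℕ} (ν : FramedSphereFamily IX X ι k (k + 1))

/-- **The meridian sphere** `v ↦ φ(u₀, ½ v)` of the framed sphere in `X ∖ S` (Kervaire–Milnor
1963, proof of Lemma 5.6, p. 515: "the meridian `φ(x₀ × Sᵏ)` of the torus `φ(Sᵏ × Sᵏ)`", whose
class is `ε'`). [cite: KervaireMilnorAnnals1963, Lemma 5.6, proof (p. 515)] -/
def meridianSphere (u₀ : 𝕊 k) : C(𝕊 k, ↥ν.complement) :=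
  ν.tubeIncl.comp (meridianPT (k := k) (l := k) u₀)

/-- The parallel sphere of the tree (`parallelSphere`) is the parallel of the punctured tube
(`parallelPT`) mapped into `X ∖ S` (definitional). [folklore] -/
theorem tubeIncl_comp_parallelPT {v₀ : 𝔼 (k + 1)} (hv₀ : v₀ ≠ 0) (hv₁ : ‖v₀‖ < 1) :
    ν.tubeIncl.comp (parallelPT (k := k) hv₀ hv₁) = ν.parallelSphere hv₀ := by
  ext u : 1
  rfl

/-! ### Kervaire–Milnor's horizontal sequence: `H_kM₀ → H_kM` is onto with kernel `ε'(Z)` -/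

/-- **`H_k(X ∖ S) → H_k(X)` is onto with kernel generated by the meridian class** (`k ≥ 2`).
Kervaire–Milnor 1963, proof of Lemma 5.6 (p. 515), horizontal exact sequence
`H_{k+1}(M, M₀) ≅ Z →ε'→ H_kM₀ →i→ H_kM → H_k(M, M₀) = 0`: "The element `ε' = ε'(1) ∈ H_kM₀` can
clearly be described as the homology class corresponding to the meridian `φ(x₀ × Sᵏ)`". Here for the
open model `M₀ = X ∖ S` (which contains `M ∖ int φ(Sᵏ × Dᵏ⁺¹)` as a deformation retract) and by
Mayer–Vietoris for `X = (X ∖ S) ∪ φ(Sᵏ × Bᵏ⁺¹)` rather than by excision: the pieces meet in the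
punctured tube, whose `H_k` is generated by the meridian and the parallel and whose `H_{k-1}`
vanishes (`k ≥ 2`); in the tube `≃ Sᵏ` the meridian dies and the parallel is a generator; the
diagram chase is `surjective_and_ker_eq_zmultiples_of_mayerVietoris`. Stated for a generator `θ`
of `H_k(Sᵏ; ℤ)`, the meridian class being `(meridianSphere u₀)_* θ`.
[cite: KervaireMilnorAnnals1963, Lemma 5.6, proof (p. 515), horizontal sequence] -/
theorem surjective_map_complement_and_ker_eq (hk : 2 ≤ k)
    {θ : singularHomology ℤ ℤ (𝕊 k) k} (hθ : zmultiples θ = ⊤) (u₀ : 𝕊 k) :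
    Function.Surjective (singularHomology.map ℤ ℤ (subsetIncl (ν.complement : Set X)) k) ∧
      (singularHomology.map ℤ ℤ (subsetIncl (ν.complement : Set X)) k).hom.toAddMonoidHom.ker =
        zmultiples (singularHomology.map ℤ ℤ (ν.meridianSphere u₀) k θ) := by
  obtain ⟨j, rfl⟩ : ∃ j, k = j + 1 := ⟨k - 1, by omega⟩
  -- the cover, its pieces and their models
  set U : Set X := (ν.complement : Set X) with hU
  set T : Set X := ν.openTube with hT
  have hUo : IsOpen U := ν.complement.isOpen
  have hTo : IsOpen T := ν.isOpen_openTube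
  have hcov : U ∪ T = univ := ν.complement_union_openTube
  have hint : interior U ∪ interior T = univ := by rw [hUo.interior_eq, hTo.interior_eq, hcov]
  have hexc := relativeSingularHomology.isIso_map_of_interior_union_interior_holds ℤ ℤ X
  let eI : ↥(puncturedUnitTube (j + 1) (j + 1)) ≃ₜ ↥(U ∩ T) := ν.interHomeomorph
  let eT : ↥(unitTube (j + 1) (j + 1)) ≃ₜ ↥T := ν.openTubeHomeomorph
  let eIc : C(↥(puncturedUnitTube (j + 1) (j + 1)), ↥(U ∩ T)) := eI
  let eTc : C(↥(unitTube (j + 1) (j + 1)), ↥T) := eT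
  let v₀ : 𝔼 (j + 1 + 1) := (2⁻¹ : ℝ) • (spherePt (j + 1) : 𝔼 (j + 1 + 1))
  have hv₀ : v₀ ≠ 0 := smul_ne_zero (by norm_num) (ne_zero_of_mem_unit_sphere _)
  have hv₁ : ‖v₀‖ < 1 := by
    show ‖(2⁻¹ : ℝ) • (spherePt (j + 1) : 𝔼 (j + 1 + 1))‖ < 1
    rw [norm_smul_coe_sphere (by norm_num)]; norm_num
  -- the four maps of the Mayer–Vietoris sequence, as homomorphisms of abelian groups
  let a₁ := (singularHomology.map ℤ ℤ (subsetInclusion (inter_subset_left : U ∩ T ⊆ U)) (j + 1)).hom.toAddMonoidHom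
  let a₂ := (singularHomology.map ℤ ℤ (subsetInclusion (inter_subset_right : U ∩ T ⊆ T)) (j + 1)).hom.toAddMonoidHom
  let u := (singularHomology.map ℤ ℤ (subsetIncl U) (j + 1)).hom.toAddMonoidHom
  let w := (singularHomology.map ℤ ℤ (subsetIncl T) (j + 1)).hom.toAddMonoidHom
  -- the two classes of the intersection
  let m := singularHomology.map ℤ ℤ (eIc.comp (meridianPT (k := j + 1) (l := j + 1) u₀)) (j + 1) θ
  let p := singularHomology.map ℤ ℤ (eIc.comp (parallelPT (k := j + 1) hv₀ hv₁)) (j + 1) θ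
  -- (1) `u ∘ a₁ = w ∘ a₂`
  have hcomp : ∀ z, u (a₁ z) = w (a₂ z) := by
    intro z
    change (singularHomology.map ℤ ℤ (subsetInclusion inter_subset_left) (j + 1) ≫
        singularHomology.map ℤ ℤ (subsetIncl U) (j + 1)) z =
      (singularHomology.map ℤ ℤ (subsetInclusion inter_subset_right) (j + 1) ≫
        singularHomology.map ℤ ℤ (subsetIncl T) (j + 1)) z
    rw [← singularHomology.map_comp, ← singularHomology.map_comp]
    rfl
  -- (2) `ψ` is onto: `H_j` of the intersection vanishes (`j = k - 1`, `0 < j < k`)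
  have hI0 : IsZero (singularHomology ℤ ℤ ↥(U ∩ T) j) := by
    rcases Nat.eq_zero_or_pos j with hj | hj
    · omega
    · exact (isZero_singularHomology_puncturedTube ℤ ℤ (k := j + 1) (l := j + 1) hj.ne'
        (by omega) (by omega)).of_iso (singularHomology.mapIso ℤ ℤ eI.symm j)
  have hsurjψ : Function.Surjective (mayerVietoris.ψ ℤ ℤ U T (j + 1)) := by
    haveI : Epi (mayerVietoris.ψ ℤ ℤ U T (j + 1)) :=
      (mayerVietoris.exact₂_holds ℤ ℤ U T hexc hint j).epi_f (hI0.eq_of_tgt _ _)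
    exact (ModuleCat.epi_iff_surjective _).1 inferInstance
  have hsurj : ∀ y, ∃ x v, u x + w v = y := by
    intro y
    obtain ⟨b, hb⟩ := hsurjψ y
    refine ⟨(biprod.fst : _ ⊞ _ ⟶ singularHomology ℤ ℤ ↥U (j + 1)) b,
      (biprod.snd : _ ⊞ _ ⟶ singularHomology ℤ ℤ ↥T (j + 1)) b, ?_⟩
    rw [← hb, mayerVietoris.ψ, biprod_desc_apply]
    rfl
  -- (3) exactness at `H(U) ⊕ H(T)`
  have hexact : ∀ x v, u x + w v = 0 → ∃ z, a₁ z = x ∧ -a₂ z = v := by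
    intro x v hxv
    let HU := singularHomology ℤ ℤ ↥U (j + 1)
    let HT := singularHomology ℤ ℤ ↥T (j + 1)
    have hex := (ShortComplex.moduleCat_exact_iff _).1
      (mayerVietoris.exact₁_holds ℤ ℤ U T hint (j + 1))
    let x₂ : ↑(HU ⊞ HT) := (biprod.inl : HU ⟶ HU ⊞ HT) x + (biprod.inr : HT ⟶ HU ⊞ HT) v
    have hfst : (biprod.fst : HU ⊞ HT ⟶ HU) x₂ = x := by
      change (biprod.fst : HU ⊞ HT ⟶ HU) ((biprod.inl : HU ⟶ HU ⊞ HT) x + (biprod.inr : HT ⟶ HU ⊞ HT) v) = x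
      rw [map_add, ← ModuleCat.comp_apply, ← ModuleCat.comp_apply, biprod.inl_fst, biprod.inr_fst]
      simp
    have hsnd : (biprod.snd : HU ⊞ HT ⟶ HT) x₂ = v := by
      change (biprod.snd : HU ⊞ HT ⟶ HT) ((biprod.inl : HU ⟶ HU ⊞ HT) x + (biprod.inr : HT ⟶ HU ⊞ HT) v) = v
      rw [map_add, ← ModuleCat.comp_apply, ← ModuleCat.comp_apply, biprod.inl_snd, biprod.inr_snd]
      simp
    have hx₂ : mayerVietoris.ψ ℤ ℤ U T (j + 1) x₂ = 0 := by
      change mayerVietoris.ψ ℤ ℤ U T (j + 1)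
        ((biprod.inl : HU ⟶ HU ⊞ HT) x + (biprod.inr : HT ⟶ HU ⊞ HT) v) = 0
      rw [map_add, mayerVietoris.ψ, biprod_desc_inl_apply, biprod_desc_inr_apply]
      exact hxv
    obtain ⟨z, hz⟩ := hex x₂ hx₂
    change mayerVietoris.φ ℤ ℤ U T (j + 1) z = x₂ at hz
    refine ⟨z, ?_, ?_⟩
    · have h1 := congrArg (biprod.fst : HU ⊞ HT ⟶ HU) hz
      rw [mayerVietoris.φ, biprod_fst_lift_apply, hfst] at h1
      exact h1
    · have h2 := congrArg (biprod.snd : HU ⊞ HT ⟶ HT) hz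
      rw [mayerVietoris.φ, biprod_snd_lift_apply, hsnd] at h2
      rw [← h2]
      rfl
  -- (4) `H_k` of the intersection is generated by the meridian and the parallel
  have hgen : ∀ z : singularHomology ℤ ℤ ↥(U ∩ T) (j + 1), ∃ c₁ c₂ : ℤ, z = c₁ • m + c₂ • p := by
    intro z
    obtain ⟨c₁, c₂, hz⟩ := exists_eq_zsmul_meridianPT_add_zsmul_parallelPT hk hθ u₀ hv₀ hv₁
      ((singularHomology.mapIso ℤ ℤ eI (j + 1)).inv z)
    refine ⟨c₁, c₂, ?_⟩
    have hz' := congrArg (singularHomology.mapIso ℤ ℤ eI (j + 1)).hom hz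
    rw [← ModuleCat.comp_apply, Iso.inv_hom_id, ModuleCat.id_apply] at hz'
    rw [hz', singularHomology.mapIso_hom, map_add, map_zsmul, map_zsmul, ← ModuleCat.comp_apply,
      ← ModuleCat.comp_apply, ← singularHomology.map_comp, ← singularHomology.map_comp]
  -- (5) in the tube the meridian dies …
  have hmT : (subsetInclusion (inter_subset_right : U ∩ T ⊆ T)).comp
      (eIc.comp (meridianPT (k := j + 1) (l := j + 1) u₀)) =
      eTc.comp ((inclPT (j + 1) (j + 1)).comp (meridianPT (k := j + 1) (l := j + 1) u₀)) := by
    ext v : 1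
    rfl
  have hm : a₂ m = 0 := by
    change (singularHomology.map ℤ ℤ (eIc.comp (meridianPT (k := j + 1) (l := j + 1) u₀)) (j + 1) ≫
      singularHomology.map ℤ ℤ (subsetInclusion inter_subset_right) (j + 1)) θ = 0
    rw [← singularHomology.map_comp, hmT, singularHomology.map_comp,
      map_inclPT_comp_meridianPT (Nat.succ_ne_zero j), zero_comp]
    rfl
  -- … and the parallel is a generator of infinite order
  have hpT : (subsetInclusion (inter_subset_right : U ∩ T ⊆ T)).comp
      (eIc.comp (parallelPT (k := j + 1) hv₀ hv₁)) =
      eTc.comp ((inclPT (j + 1) (j + 1)).comp (parallelPT (k := j + 1) hv₀ hv₁)) := by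
    ext v : 1
    rfl
  haveI hslice := isIso_map_inclPT_comp_parallelPT (k := j + 1) hv₀ hv₁ (j + 1)
  have ha₂p : a₂ p = (singularHomology.map ℤ ℤ
      ((inclPT (j + 1) (j + 1)).comp (parallelPT (k := j + 1) hv₀ hv₁)) (j + 1) ≫
        singularHomology.map ℤ ℤ eTc (j + 1)) θ := by
    change (singularHomology.map ℤ ℤ (eIc.comp (parallelPT (k := j + 1) hv₀ hv₁)) (j + 1) ≫
      singularHomology.map ℤ ℤ (subsetInclusion inter_subset_right) (j + 1)) θ = _
    rw [← singularHomology.map_comp, hpT, singularHomology.map_comp]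
  have hbij : Function.Bijective (singularHomology.map ℤ ℤ
      ((inclPT (j + 1) (j + 1)).comp (parallelPT (k := j + 1) hv₀ hv₁)) (j + 1) ≫
        singularHomology.map ℤ ℤ eTc (j + 1)) := by
    have h2 : singularHomology.map ℤ ℤ eTc (j + 1) = (singularHomology.mapIso ℤ ℤ eT (j + 1)).hom := rfl
    rw [h2]
    exact ConcreteCategory.bijective_of_isIso _
  have hW : ∀ y, ∃ c : ℤ, y = c • a₂ p := by
    intro y
    obtain ⟨x, rfl⟩ := hbij.2 y
    obtain ⟨c, rfl⟩ := mem_zmultiples_iff.1 (hθ.symm ▸ mem_top x : x ∈ zmultiples θ)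
    exact ⟨c, by rw [ha₂p, map_zsmul]⟩
  have hp : ∀ c : ℤ, c • a₂ p = 0 → c = 0 := by
    intro c hc
    rw [ha₂p, ← map_zsmul] at hc
    have h0 : c • θ = 0 := hbij.1 (hc.trans (map_zero _).symm)
    exact eq_zero_of_zsmul_generator_eq_zero (by omega) hθ h0
  -- (6) the diagram chase
  obtain ⟨hs, hker⟩ := Literature.GroupTheory.FiniteAbelian.surjective_and_ker_eq_zmultiples_of_mayerVietoris
    a₁ a₂ u w hcomp hsurj hexact hgen hm hW hp
  refine ⟨hs, ?_⟩
  -- `a₁ m` is the meridian class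
  have hmU : (subsetInclusion (inter_subset_left : U ∩ T ⊆ U)).comp
      (eIc.comp (meridianPT (k := j + 1) (l := j + 1) u₀)) = ν.meridianSphere u₀ := by
    ext v : 1
    rfl
  have ha₁m : a₁ m = singularHomology.map ℤ ℤ (ν.meridianSphere u₀) (j + 1) θ := by
    change (singularHomology.map ℤ ℤ (eIc.comp (meridianPT (k := j + 1) (l := j + 1) u₀)) (j + 1) ≫
      singularHomology.map ℤ ℤ (subsetInclusion inter_subset_left) (j + 1)) θ = _
    rw [← singularHomology.map_comp, hmU]
  rw [← ha₁m]
  exact hker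

end FramedSphereFamily


end Literature.Topology.FourManifolds

end
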